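import Summits.AtomisticToContinuum.HydrodynamicLimit.Theorems.EquilibriumClampedCollisionalWindowLD.Negative.TorusTools

/-!
# The test function `cos 2π x₀` (helper file of the refutation of `EquilibriumClampedCollisionalWindowLD`, stmt-AtomisticToContinuum-13733; see `Cruxes/EquilibriumClampedCollisionalWindowLD/Disproof.lean` and the evidence WITNESS.md; no Theses declaration is asserted positively; refuter-cdisprove-stmt-AtomisticToContinuum-13733-0)
-/

noncomputable section

open Real
open scoped InnerProductSpace

namespace Summit.AtomisticToContinuum.HydrodynamicLimit.Theorems

namespace EquilibriumClampedCollisionalWindowLDNegative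

/-! ### The test function `φ(x) = cos(2π x₀)` -/

section TestFunction

open Literature.Analysis.FluidPDE Literature.Analysis.FunctionSpaces

/-- `t ↦ cos (2π t)`. -/
def c2π (t : ℝ) : ℝ := Real.cos (2 * Real.pi * t)

/-- `c2π_periodic` (technical, see the section header). [folklore] -/
theorem c2π_periodic : Function.Periodic c2π 1 := by
  intro t; unfold c2π
  rw [mul_add, mul_one, Real.cos_add_two_pi]

/-- `cos(2π ·)` on the circle. -/
def cosU : AddCircle (1 : ℝ) → ℝ := c2π_periodic.lift

/-- `cosU_coe` (technical, see the section header). [folklore] -/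
theorem cosU_coe (t : ℝ) : cosU (t : AddCircle (1 : ℝ)) = Real.cos (2 * Real.pi * t) :=
  c2π_periodic.lift_coe t

/-- **The test function of the refutation**: `φ(x) = cos(2π x₀)`. [folklore] -/
def phi : UnitAddTorus (Fin 3) → ℝ := fun x => cosU (x 0)

/-- `phi_proj` (technical, see the section header). [folklore] -/
theorem phi_proj (y : E3) : phi (Torus.proj y) = Real.cos (2 * Real.pi * y 0) := by
  unfold phi; rw [Torus.proj_apply, cosU_coe]

/-- `lift_phi` (technical, see the section header). [folklore] -/
theorem lift_phi : Torus.lift phi = fun y : E3 => Real.cos (2 * Real.pi * y 0) := by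
  funext y; rw [Torus.lift_apply, phi_proj]

/-- The linear map `y ↦ 2π y₀`. -/
def ℓ0 : E3 →L[ℝ] ℝ := (2 * Real.pi) • EuclideanSpace.proj (0 : Fin 3)

/-- `ℓ0_apply` (technical, see the section header). [folklore] -/
theorem ℓ0_apply (y : E3) : ℓ0 y = 2 * Real.pi * y 0 := by
  simp [ℓ0]

/-- `hasFDerivAt_lift_phi` (technical, see the section header). [folklore] -/
theorem hasFDerivAt_lift_phi (y : E3) :
    HasFDerivAt (Torus.lift phi) ((-Real.sin (2 * Real.pi * y 0)) • ℓ0) y := by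
  rw [lift_phi]
  have h1 : HasFDerivAt (fun y : E3 => 2 * Real.pi * y 0) ℓ0 y := by
    have := ℓ0.hasFDerivAt (x := y)
    convert this using 1
    funext v; rw [ℓ0_apply]
  have h2 := (Real.hasDerivAt_cos (2 * Real.pi * y 0)).comp_hasFDerivAt y h1
  exact h2

/-- `φ` is smooth. [folklore] -/
theorem isSmooth_phi : Torus.IsSmooth phi := by
  unfold Torus.IsSmooth
  have h : Torus.lift phi = fun y : E3 => Real.cos (ℓ0 y) := by
    rw [lift_phi]; funext y; rw [ℓ0_apply]
  rw [h]
  exact Real.contDiff_cos.comp ℓ0.contDiff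

/-- **The partial derivatives of `φ` are bounded by `2π`.** [folklore] -/
theorem abs_partialDeriv_phi_le (i : Fin 3) (x : UnitAddTorus (Fin 3)) : |Torus.partialDeriv i phi x| ≤ 2 * Real.pi := by
  obtain ⟨y, rfl⟩ := Torus.proj_surjective x
  rw [Torus.partialDeriv_eq_fderiv_apply (isSmooth_phi.isContDiff (by simp)) i, ← Torus.fderiv_lift,
    (hasFDerivAt_lift_phi y).fderiv, FunLike.coe_smul, Pi.smul_apply, ℓ0_apply, smul_eq_mul]
  have hs := Real.abs_sin_le_one (2 * Real.pi * y 0)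
  have hv : |(EuclideanSpace.single i (1 : ℝ) : E3) 0| ≤ 1 := by
    rw [show (EuclideanSpace.single i (1 : ℝ) : E3) 0 = if (0 : Fin 3) = i then 1 else 0 from
      PiLp.single_apply _ _ _ _ _]; split_ifs <;> simp
  rw [abs_mul, abs_mul, abs_neg, abs_of_pos (by positivity : (0 : ℝ) < 2 * Real.pi)]
  have hπ : 0 < 2 * Real.pi := by positivity
  calc |Real.sin (2 * Real.pi * y 0)| * (2 * Real.pi * |(EuclideanSpace.single i (1 : ℝ) : E3) 0|)
      ≤ 1 * (2 * Real.pi * 1) := by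
        refine mul_le_mul hs (mul_le_mul_of_nonneg_left hv hπ.le) (by positivity) zero_le_one
    _ = 2 * Real.pi := by ring

/-- `sin ≤ -1/2` on `[7π/6, 11π/6]`. [folklore] -/
theorem sin_le_neg_half {X : ℝ} (h1 : 7 * Real.pi / 6 ≤ X) (h2 : X ≤ 11 * Real.pi / 6) : Real.sin X ≤ -1 / 2 := by
  have hX : X = (X - 3 * Real.pi / 2) + Real.pi / 2 + Real.pi := by ring
  rw [hX, Real.sin_add_pi, Real.sin_add_pi_div_two, ← Real.cos_abs]
  have hy : |X - 3 * Real.pi / 2| ≤ Real.pi / 3 := by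
    rw [abs_le]; constructor <;> linarith
  have := Real.cos_le_cos_of_nonneg_of_le_pi (abs_nonneg _) (by linarith [Real.pi_pos]) hy
  rw [Real.cos_pi_div_three] at this
  linarith

/-- **The cosine gain**: for `y ∈ [7/12 - δ, 11/12 + δ]` and a small step `e ≥ 0`,
`cos(2π(y+e)) - cos(2π y) ≥ (2 - 4h) e` with `h = 2πδ + πe ≤ 1/2`. [folklore] -/
theorem cos_gain {y δ e : ℝ} (hδ0 : 0 ≤ δ) (hy1 : 7 / 12 - δ ≤ y) (hy2 : y ≤ 11 / 12 + δ) (he0 : 0 ≤ e)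
    (hh : 2 * Real.pi * δ + Real.pi * e ≤ 1 / 2) :
    (2 - 4 * (2 * Real.pi * δ + Real.pi * e)) * e ≤ Real.cos (2 * Real.pi * (y + e)) - Real.cos (2 * Real.pi * y) := by
  have hπ := Real.pi_pos
  have hπ3 : 3 < Real.pi := Real.pi_gt_three
  set h := 2 * Real.pi * δ + Real.pi * e with hdef
  have hh0 : 0 ≤ h := by rw [hdef]; positivity
  have hπe : 0 ≤ Real.pi * e := by positivity
  have hπδ : 0 ≤ 2 * Real.pi * δ := by positivity
  rw [Real.cos_sub_cos]
  have hA : (2 * Real.pi * (y + e) + 2 * Real.pi * y) / 2 = 2 * Real.pi * y + Real.pi * e := by ring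
  have hB : (2 * Real.pi * (y + e) - 2 * Real.pi * y) / 2 = Real.pi * e := by ring
  rw [hA, hB]
  set X := 2 * Real.pi * y + Real.pi * e with hXdef
  have hXlo : 7 * Real.pi / 6 - h ≤ X := by
    have : 2 * Real.pi * (7 / 12 - δ) ≤ 2 * Real.pi * y := mul_le_mul_of_nonneg_left hy1 (by positivity)
    rw [hXdef, hdef]; nlinarith
  have hXhi : X ≤ 11 * Real.pi / 6 + h := by
    have : 2 * Real.pi * y ≤ 2 * Real.pi * (11 / 12 + δ) := mul_le_mul_of_nonneg_left hy2 (by positivity)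
    rw [hXdef, hdef]; nlinarith
  -- clamp the midpoint into `[7π/6, 11π/6]`
  obtain ⟨X', hX'1, hX'2, hdist⟩ : ∃ X', 7 * Real.pi / 6 ≤ X' ∧ X' ≤ 11 * Real.pi / 6 ∧ |X - X'| ≤ h := by
    by_cases h7 : X < 7 * Real.pi / 6
    · exact ⟨7 * Real.pi / 6, le_rfl, by nlinarith, by rw [abs_le]; constructor <;> linarith⟩
    by_cases h11 : 11 * Real.pi / 6 < X
    · exact ⟨11 * Real.pi / 6, by nlinarith, le_rfl, by rw [abs_le]; constructor <;> linarith⟩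
    · push Not at h7 h11
      exact ⟨X, h7, h11, by simp [hh0]⟩
  have hsinX : Real.sin X ≤ -(1 / 2 - h) := by
    have h1 := sin_le_neg_half hX'1 hX'2
    have h2 := Real.abs_sin_sub_sin_le X X'
    have h3 : Real.sin X - Real.sin X' ≤ h := (le_abs_self _).trans (h2.trans hdist)
    linarith
  -- Jordan's inequality for the small factor
  have he' : Real.pi * e ≤ Real.pi / 2 := by nlinarith [hh, hh0]
  have hsin_e : 2 * e ≤ Real.sin (Real.pi * e) := by
    have := Real.mul_le_sin hπe he'
    calc 2 * e = 2 / Real.pi * (Real.pi * e) := by field_simp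
      _ ≤ _ := this
  have hpos1 : 0 ≤ 1 / 2 - h := by linarith
  calc (2 - 4 * h) * e = 2 * (1 / 2 - h) * (2 * e) := by ring
    _ ≤ 2 * (-Real.sin X) * Real.sin (Real.pi * e) := by
        have := mul_le_mul (by linarith : (1 / 2 - h) ≤ -Real.sin X) hsin_e (by positivity) (by linarith)
        linarith
    _ = -2 * Real.sin X * Real.sin (Real.pi * e) := by ring

end TestFunction


end EquilibriumClampedCollisionalWindowLDNegative

end Summit.AtomisticToContinuum.HydrodynamicLimit.Theorems

end
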